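/-
Copyright (c) 2026. All rights reserved.
Released under Apache 2.0 license as described in the file LICENSE.
Authors: abc-iut cell, prover seat abc-iut-L6-t14 (wave 2, generation 2).
-/
import Literature.RingTheory.MvPowerSeries.AdicEvaluation
import Mathlib.Algebra.MvPolynomial.Funext
import Mathlib.RingTheory.PowerSeries.Basic
import HarnessLib

/-!
# Nonzero values of functions defined by power series ([AbsTopII] Lemma 2.3)

Topic `Literature/RingTheory/MvPowerSeries` (proofs only). S. Mochizuki, *Topics in Absolute
Anabelian Geometry II*, J. Math. Sci. Univ. Tokyo 20 (2013) [MochizukiAbsTopII2013], Lemma 2.3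
p. 33 (manuscript pagination, lit key `paper:url-585b8d0ad0d9`): "Let `k, 𝒪_k, A` be as in
Lemma 2.1 [`k` complete discretely valued, `A = 𝒪_k[[X₁, …, X_m]]`]; `f = f(X₁, …, X_m) ∈ A` a
nonzero element. Then there exist elements `xᵢ ∈ 𝔪_k`, where `i = 1, …, m`, such that
`f(x₁, …, x_m) ∈ 𝔪_k` is nonzero."  We prove the conclusion `f(x) ≠ 0` (`exists_adicEval_ne_zero`)
for any integral domain `A` complete and separated in the `I`-adic topology of a nonzero ideal
`I` (values = adic evaluation, `AdicEvaluation.lean`); the display's "`∈ 𝔪_k`" holds when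
`f(0) ∈ 𝔪_k` (`adicEval_mem_of_constantCoeff_mem`) and is not used by the proof of [AbsTopII]
Lemma 2.1, whose `g = det M` may be a unit (for `f = 1` the value is `1 ∉ 𝔪_k`); nothing else is
claimed about the printed sentence.

Proof. One variable (`exists_adicEval_ne_zero_powerSeries`, the printed argument): write
`f = X^j (c + X h)` with `c ≠ 0`, pick `s ≥ 1` with `c ∉ I^s` (separatedness) and `0 ≠ t ∈ I^s`;
then `f(t) = t^j (c + t h(t))` and `c + t h(t) ≠ 0` since `t h(t) ∈ I^s ∌ c`. Several variables:
the print inducts on `m` through `𝒪_k[[X₁,…,X_{m-1}]][[X_m]]`; we instead restrict to the curve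
`t ↦ t·x`: if `f ≠ 0` some homogeneous component `f_k` is a nonzero polynomial, which is nonzero at
some `x ∈ I^m` (`I` is infinite; Mathlib `MvPolynomial.funext_set`), so that
`g(T) := Σ_k f_k(x) T^k ≠ 0` and `f(t·x) = g(t)` (`adicEval_smul_eq_adicEval_powerSeries`),
reducing to one variable. Nothing is asserted beyond what is proved.
-/

noncomputable section

namespace Literature.RingTheory.MvPowerSeries

open _root_.MvPowerSeries

universe u v

variable {A : Type u} [CommRing A] {I : Ideal A}

/-! ### Preliminaries on complete integral domains -/

section Prelim

variable [IsAdicComplete I A]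

/-- A nonzero element of an `I`-adically separated ring lies outside some power `I^s`, `s ≥ 1`.
[cite: MochizukiAbsTopII2013, Lemma 2.3 p.33] -/
theorem exists_not_mem_pow {c : A} (hc : c ≠ 0) : ∃ s : ℕ, 0 < s ∧ c ∉ I ^ s := by
  by_contra h
  push Not at h
  apply hc
  refine eq_of_forall_sub_mem_pow (I := I) fun N => ?_
  rw [sub_zero]
  rcases Nat.eq_zero_or_pos N with hN | hN
  · rw [hN, pow_zero, Ideal.one_eq_top]; exact Submodule.mem_top
  · exact h N hN

variable [IsDomain A]

omit [IsAdicComplete I A] in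
/-- In an integral domain, a power of a nonzero ideal contains a nonzero element.
[cite: MochizukiAbsTopII2013, Lemma 2.3 p.33] -/
theorem exists_mem_pow_ne_zero (hI : I ≠ ⊥) (s : ℕ) : ∃ t ∈ I ^ s, t ≠ 0 := by
  have hIs : I ^ s ≠ ⊥ := pow_ne_zero s hI
  rw [Ne, Submodule.eq_bot_iff] at hIs
  push Not at hIs
  exact hIs

omit [IsDomain A] in
/-- A proper... : the defining ideal of a nontrivial adically complete ring is not `⊤`.
[cite: MochizukiAbsTopII2013, Lemma 2.3 p.33] -/
theorem ne_top_of_isAdicComplete [Nontrivial A] : I ≠ ⊤ := by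
  intro hI
  have : (1 : A) = 0 := eq_of_forall_sub_mem_pow (I := I) fun N => by
    rw [hI, Ideal.top_pow]; exact Submodule.mem_top
  exact one_ne_zero this

/-- A nonzero ideal of an adically complete integral domain is infinite (it contains the distinct
powers of any of its nonzero elements). [cite: MochizukiAbsTopII2013, Lemma 2.3 p.33] -/
theorem infinite_of_ne_bot (hI : I ≠ ⊥) : ((I : Ideal A) : Set A).Infinite := by
  obtain ⟨t, ht, ht0⟩ := exists_mem_pow_ne_zero (I := I) hI 1
  rw [pow_one] at ht
  have htu : ¬ IsUnit t := fun hu =>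
    ne_top_of_isAdicComplete (I := I) (Ideal.eq_top_of_isUnit_mem I ht hu)
  refine Set.infinite_of_injective_forall_mem (f := fun k : ℕ => t ^ (k + 1))
    (fun k l hkl => ?_) (fun k => ?_)
  · have := pow_injective_of_not_isUnit htu ht0 hkl
    simpa using this
  · rw [pow_succ]
    exact Ideal.mul_mem_left _ _ ht

end Prelim

/-! ### One variable -/

/-- **[AbsTopII] Lemma 2.3, one variable**: over an integral domain `A` complete and separated for
a nonzero ideal `I`, a nonzero power series `g ∈ A⟦T⟧` has a nonzero value `g(t)` at some
`0 ≠ t ∈ I` (the printed argument: the lowest term dominates at `t ∈ I^s` when the lowest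
coefficient is `∉ I^s`). [cite: MochizukiAbsTopII2013, Lemma 2.3 p.33] -/
theorem exists_adicEval_ne_zero_powerSeries [IsDomain A] [IsAdicComplete I A] (hI : I ≠ ⊥)
    {g : PowerSeries A} (hg : g ≠ 0) :
    ∃ t : A, t ∈ I ∧ t ≠ 0 ∧ adicEval I (fun _ : Unit => t) g ≠ 0 := by
  classical
  -- the lowest nonzero coefficient `c = g_j`
  have hex : ∃ j, PowerSeries.coeff j g ≠ 0 := by
    by_contra h
    push Not at h
    exact hg (PowerSeries.ext fun j => by rw [h j, map_zero])
  let j := Nat.find hex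
  have hj : PowerSeries.coeff j g ≠ 0 := Nat.find_spec hex
  have hlt : ∀ i < j, PowerSeries.coeff i g = 0 := fun i hi => by
    have := Nat.find_min hex hi
    rwa [not_not] at this
  set c := PowerSeries.coeff j g with hc
  obtain ⟨s, hs, hcs⟩ := exists_not_mem_pow (I := I) hj
  obtain ⟨t, hts, ht0⟩ := exists_mem_pow_ne_zero (I := I) hI s
  have htI : t ∈ I := Ideal.pow_le_self (by omega) hts
  -- `g = T^j · q`, `q = c + T · q'`
  let q : PowerSeries A := PowerSeries.mk fun i => PowerSeries.coeff (i + j) g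
  have hgq : g = PowerSeries.X ^ j * q := by
    ext i
    rw [PowerSeries.coeff_X_pow_mul']
    split_ifs with h
    · rw [PowerSeries.coeff_mk, Nat.sub_add_cancel h]
    · exact hlt i (not_le.mp h)
  have hq0 : PowerSeries.constantCoeff q = c := by
    rw [← PowerSeries.coeff_zero_eq_constantCoeff_apply, PowerSeries.coeff_mk, zero_add]
  let q' : PowerSeries A := PowerSeries.mk fun p => PowerSeries.coeff (p + 1) q
  have hqq' : q = PowerSeries.X * q' + PowerSeries.C c := by
    rw [← hq0]; exact PowerSeries.eq_X_mul_shift_add_const q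
  refine ⟨t, htI, ht0, fun h0 => hcs ?_⟩
  have hx : ∀ _ : Unit, (fun _ : Unit => t) () ∈ I := fun _ => htI
  -- evaluate: `g(t) = t^j (t q'(t) + c)`
  have hX : adicEval I (fun _ : Unit => t) (PowerSeries.X : PowerSeries A) = t :=
    adicEval_X I (fun _ : Unit => t) ()
  have hev : adicEval I (fun _ : Unit => t) g =
      t ^ j * (t * adicEval I (fun _ : Unit => t) q' + c) := by
    rw [hgq, adicEval_mul hx, ← adicEvalHom_apply hx, map_pow, adicEvalHom_apply hx, hX,
      hqq', adicEval_add hx, adicEval_mul hx, hX]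
    show _ = _
    rw [show (PowerSeries.C c : PowerSeries A) = (C c : MvPowerSeries Unit A) from rfl, adicEval_C]
  rw [hev] at h0
  have h1 : t * adicEval I (fun _ : Unit => t) q' + c = 0 :=
    (mul_eq_zero.mp h0).resolve_left (pow_ne_zero j ht0)
  have h2 : c = -(t * adicEval I (fun _ : Unit => t) q') := eq_neg_of_add_eq_zero_right h1
  rw [h2]
  exact (I ^ s).neg_mem (Ideal.mul_mem_right _ _ hts)

/-! ### Several variables: restriction to the curve `t ↦ t·x` -/

section Several

variable {τ : Type v} [Fintype τ]

/-- The degree of an exponent in one variable is its value.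
[cite: MochizukiAbsTopII2013, Lemma 2.3 p.33] -/
theorem degree_unit (e : Unit →₀ ℕ) : e.degree = e () := by
  rw [Finsupp.degree_eq_sum, Fintype.sum_unique]

variable [IsAdicComplete I A]

/-- **Restriction of a power series to the curve `t ↦ t·x`**: for `x ∈ I^τ`, `t ∈ I` and
`f ∈ A⟦X⟧`, `f(t·x) = g(t)` where `g(T) = Σ_k f_k(x) T^k ∈ A⟦T⟧` and `f_k` is the degree-`k`
homogeneous component of `f` (a polynomial). [cite: MochizukiAbsTopII2013, Lemma 2.3 p.33] -/
theorem adicEval_smul_eq_adicEval_powerSeries {x : τ → A} (hx : ∀ s, x s ∈ I) {t : A} (ht : t ∈ I)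
    (f : MvPowerSeries τ A) :
    adicEval I (t • x) f = adicEval I (fun _ : Unit => t)
      (PowerSeries.mk fun k => MvPolynomial.eval x
        (∑ e ∈ (Finsupp.finite_of_degree_eq (σ := τ) k).toFinset,
          MvPolynomial.monomial e (coeff e f))) := by
  classical
  set g : PowerSeries A := PowerSeries.mk fun k => MvPolynomial.eval x
    (∑ e ∈ (Finsupp.finite_of_degree_eq (σ := τ) k).toFinset,
      MvPolynomial.monomial e (coeff e f)) with hg
  have htx : ∀ s, (t • x) s ∈ I := fun s => by
    rw [Pi.smul_apply, smul_eq_mul]; exact I.mul_mem_left _ (hx s)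
  have ht' : ∀ _ : Unit, (fun _ : Unit => t) () ∈ I := fun _ => ht
  refine eq_of_forall_sub_mem_pow (I := I) fun N => ?_
  have h1 := adicEval_sub_eval_truncTotal_mem_pow htx f N
  have h2 := adicEval_sub_eval_truncTotal_mem_pow (τ := Unit) ht' g N
  -- the two truncations have the same value
  have hD : ∀ k, MvPolynomial.eval x (∑ e ∈ (Finsupp.finite_of_degree_eq (σ := τ) k).toFinset,
      MvPolynomial.monomial e (coeff e f)) =
      ∑ e ∈ (Finsupp.finite_of_degree_eq (σ := τ) k).toFinset,
        coeff e f * e.prod fun s n => x s ^ n := by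
    intro k
    rw [map_sum]
    exact Finset.sum_congr rfl fun e _ => MvPolynomial.eval_monomial
  have hL : MvPolynomial.eval (t • x) (truncTotal N f) =
      ∑ e ∈ (Finsupp.finite_of_degree_lt (σ := τ) N).toFinset,
        coeff e f * (t ^ e.degree * e.prod fun s n => x s ^ n) := by
    rw [MvPolynomial.eval_eq]
    have hsub : ∑ e ∈ (truncTotal N f).support, MvPolynomial.coeff e (truncTotal N f) *
        ∏ i ∈ e.support, (t • x) i ^ e i =
        ∑ e ∈ (Finsupp.finite_of_degree_lt (σ := τ) N).toFinset,
          MvPolynomial.coeff e (truncTotal N f) * ∏ i ∈ e.support, (t • x) i ^ e i := by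
      refine Finset.sum_subset (fun e he => ?_) (fun e _ hes => ?_)
      · rw [Set.Finite.mem_toFinset, Set.mem_setOf_eq]
        by_contra hlt
        rw [MvPolynomial.mem_support_iff, coeff_truncTotal_eq_zero _ (not_lt.mp hlt)] at he
        exact he rfl
      · rw [MvPolynomial.notMem_support_iff] at hes
        rw [hes, zero_mul]
    rw [hsub]
    refine Finset.sum_congr rfl fun e he => ?_
    rw [Set.Finite.mem_toFinset, Set.mem_setOf_eq] at he
    rw [coeff_truncTotal _ he, ← prod_pow_smul t x e, Finsupp.prod]
  have hR : MvPolynomial.eval (fun _ : Unit => t) (truncTotal N g) =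
      ∑ k ∈ Finset.range N, (∑ e ∈ (Finsupp.finite_of_degree_eq (σ := τ) k).toFinset,
        coeff e f * e.prod fun s n => x s ^ n) * t ^ k := by
    rw [MvPolynomial.eval_eq]
    have hsub : ∑ e ∈ (truncTotal N g).support, MvPolynomial.coeff e (truncTotal N g) *
        ∏ i ∈ e.support, (fun _ : Unit => t) i ^ e i =
        ∑ e ∈ (Finsupp.finite_of_degree_lt (σ := Unit) N).toFinset,
          MvPolynomial.coeff e (truncTotal N g) * ∏ i ∈ e.support, (fun _ : Unit => t) i ^ e i := by
      refine Finset.sum_subset (fun e he => ?_) (fun e _ hes => ?_)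
      · rw [Set.Finite.mem_toFinset, Set.mem_setOf_eq]
        by_contra hlt
        rw [MvPolynomial.mem_support_iff, coeff_truncTotal_eq_zero _ (not_lt.mp hlt)] at he
        exact he rfl
      · rw [MvPolynomial.notMem_support_iff] at hes
        rw [hes, zero_mul]
    rw [hsub]
    -- reindex `e ↦ e ()`
    refine Finset.sum_nbij' (fun e => e ()) (fun k => Finsupp.single () k) ?_ ?_ ?_ ?_ ?_
    · intro e he
      rw [Set.Finite.mem_toFinset, Set.mem_setOf_eq, degree_unit] at he
      exact Finset.mem_range.mpr he
    · intro k hk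
      rw [Set.Finite.mem_toFinset, Set.mem_setOf_eq, Finsupp.degree_single]
      exact Finset.mem_range.mp hk
    · intro e _
      exact (Finsupp.unique_single e).symm
    · intro k _
      exact Finsupp.single_eq_same
    · intro e he
      rw [Set.Finite.mem_toFinset, Set.mem_setOf_eq, degree_unit] at he
      rw [coeff_truncTotal _ (by rw [degree_unit]; exact he),
        show coeff e g = PowerSeries.coeff (e ()) g from by rw [PowerSeries.coeff_def rfl], hg,
        PowerSeries.coeff_mk, hD]
      congr 1
      rw [Finset.prod_subset (Finset.subset_univ e.support) (fun u _ hu => by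
        rw [Finsupp.mem_support_iff, not_not] at hu; rw [hu, pow_zero]), Fintype.prod_unique]
  have hRL : MvPolynomial.eval (fun _ : Unit => t) (truncTotal N g) =
      MvPolynomial.eval (t • x) (truncTotal N f) := by
    rw [hR, hL]
    simp_rw [Finset.sum_mul]
    rw [← Finset.sum_fiberwise_of_maps_to (s := (Finsupp.finite_of_degree_lt (σ := τ) N).toFinset)
      (t := Finset.range N) (g := fun e : τ →₀ ℕ => e.degree) (fun e he => by
        rw [Set.Finite.mem_toFinset, Set.mem_setOf_eq] at he
        exact Finset.mem_range.mpr he)]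
    refine Finset.sum_congr rfl fun k hk => ?_
    have hset : ((Finsupp.finite_of_degree_lt (σ := τ) N).toFinset.filter
        fun e : τ →₀ ℕ => e.degree = k) = (Finsupp.finite_of_degree_eq (σ := τ) k).toFinset := by
      ext e
      rw [Finset.mem_filter, Set.Finite.mem_toFinset, Set.Finite.mem_toFinset, Set.mem_setOf_eq,
        Set.mem_setOf_eq]
      constructor
      · exact fun h => h.2
      · intro h
        exact ⟨by rw [h]; exact Finset.mem_range.mp hk, h⟩
    rw [hset]
    refine Finset.sum_congr rfl fun e he => ?_
    rw [Set.Finite.mem_toFinset, Set.mem_setOf_eq] at he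
    rw [he]
    ring
  have := (I ^ N).sub_mem h1 h2
  rw [hRL] at this
  convert this using 1
  ring

/-- **[AbsTopII] Lemma 2.3 (Nonzero values of functions defined by power series)**, for any
integral domain `A` complete and separated in the `I`-adic topology of a nonzero ideal `I`
(e.g. `A = 𝒪_k`, `I = 𝔪_k` for a complete discretely valued field `k`): a nonzero
`f ∈ A⟦X_s : s ∈ τ⟧` (`τ` finite) has a nonzero value `f(x)` at some point `x ∈ I^τ`.
[cite: MochizukiAbsTopII2013, Lemma 2.3 p.33] -/
theorem exists_adicEval_ne_zero [IsDomain A] (hI : I ≠ ⊥) {f : MvPowerSeries τ A} (hf : f ≠ 0) :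
    ∃ x : τ → A, (∀ s, x s ∈ I) ∧ adicEval I x f ≠ 0 := by
  classical
  -- a nonzero homogeneous component, and a point of `I^τ` where it does not vanish
  obtain ⟨e₀, he₀⟩ : ∃ e₀, coeff e₀ f ≠ 0 := by
    by_contra h
    push Not at h
    exact hf (MvPowerSeries.ext fun e => by rw [h e, map_zero])
  set P : ℕ → MvPolynomial τ A := fun k =>
    ∑ e ∈ (Finsupp.finite_of_degree_eq (σ := τ) k).toFinset, MvPolynomial.monomial e (coeff e f)
    with hP
  have hPcoeff : ∀ k e, MvPolynomial.coeff e (P k) = if e.degree = k then coeff e f else 0 := by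
    intro k e
    simp only [hP, MvPolynomial.coeff_sum, MvPolynomial.coeff_monomial]
    rw [Finset.sum_ite_eq']
    simp only [Set.Finite.mem_toFinset, Set.mem_setOf_eq]
  have hP0 : P e₀.degree ≠ 0 := by
    intro h
    have := hPcoeff e₀.degree e₀
    rw [h, MvPolynomial.coeff_zero, if_pos rfl] at this
    exact he₀ this.symm
  obtain ⟨x, hxI, hx⟩ : ∃ x : τ → A, (∀ s, x s ∈ I) ∧ MvPolynomial.eval x (P e₀.degree) ≠ 0 := by
    by_contra hcon
    push Not at hcon
    apply hP0
    refine MvPolynomial.funext_set (fun _ => ((I : Ideal A) : Set A))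
      (fun _ => infinite_of_ne_bot (I := I) hI) fun y hy => ?_
    rw [Set.mem_univ_pi] at hy
    rw [map_zero]
    exact hcon y hy
  -- the one-variable series `g(T) = Σ_k P_k(x) T^k` is nonzero
  set g : PowerSeries A := PowerSeries.mk fun k => MvPolynomial.eval x (P k) with hg
  have hg0 : g ≠ 0 := by
    intro h
    apply hx
    have := congrArg (PowerSeries.coeff e₀.degree) h
    rwa [hg, PowerSeries.coeff_mk, map_zero] at this
  obtain ⟨t, htI, -, hgt⟩ := exists_adicEval_ne_zero_powerSeries (I := I) hI hg0
  refine ⟨t • x, fun s => ?_, ?_⟩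
  · rw [Pi.smul_apply, smul_eq_mul]; exact I.mul_mem_left _ (hxI s)
  · rw [adicEval_smul_eq_adicEval_powerSeries hxI htI f]
    exact hgt

end Several

end Literature.RingTheory.MvPowerSeries
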